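import Summits.QuantumFields.YangMills.Theorems.LangevinControlUVFemtoCurvatureSkewnessCRatioTransportDefs

/-!
# Crux `FemtoCurvatureSkewnessC` (stmt-QuantumFields-16205), line `ratio-transport`: stub `stub_signedRigidityOfRatioFloor`

The second composition stub of the skeleton `Cruxes/FemtoCurvatureSkewnessC/Lines/Sketch.lean`, PROVED
(`Sig.stub_signedRigidityOfRatioFloor = SignedRigidityOfRatioFloor`, vocabulary of
`LangevinControlUVFemtoCurvatureSkewnessCRatioTransportDefs.lean`): **a positive floor `u₁` of the tree-normalised skewness
ratio `u(L,β,n) = κ₃ · G_a / (Cov^{3/2} · G_d)` on the femto boxes of a PACKAGE map `a` gives signed rigidity there.**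

Elementary real algebra over landed facts only:
* on a package box `Cov := covAxis r L β n > 0`, from the package's lower clause `c · Γ(n · a β) ≤ n⁸ · Cov` and the positivity
  window of `Γ` (`level_mem_window`);
* `G_a := torusPropAxis L n > 0`, `G_d := torusPropDiag L n > 0` (landed `PerpPropagatorPos`, via `torusPropAxis_pos` /
  `torusPropDiag_pos`), and `ρ₀ · G_a ≤ G_d` (landed `TreeRatioFloor`, via `treeRatioFloor_holds`);
* hence `u₁ · Cov^{3/2} · G_d ≤ κ₃ · G_a` and `κ₃ · G_a ≥ u₁ ρ₀ · Cov^{3/2} · G_a`; dividing by `G_a > 0` and using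
  `Cov^{3/2} = Cov · √Cov` gives `c₃ · Cov · √Cov ≤ κ₃` with `c₃ := u₁ ρ₀`, thresholds `β₁ := max(β₁, β₀)`, `ℓ₁ := min(ℓ₁, ℓ₀)`.
-/

set_option autoImplicit false

noncomputable section

namespace Summit.QuantumFields.YangMills.Cruxes.FemtoCurvatureSkewnessC.RatioTransport

open MeasureTheory Filter Topology
open Literature.MathematicalPhysics.QuantumFieldTheory
open Summit.QuantumFields.YangMills.Theorems.FemtoCurvatureSkewness.Negative
  (plaq wE wCov kappa3 TwoPointPackage SkewnessPackage level_mem_window)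
open Summit.QuantumFields.YangMills.Cruxes.FemtoCurvatureSkewness.CouplingCubicResponse
  (covAxis torusPropAxis torusPropDiag IsHonestUnitMap SignedRigidity TreeRatioFloor treeRatioFloor_holds
    torusPropAxis_pos torusPropDiag_pos)

section Rigidity

variable {G : Type} [Group G] [TopologicalSpace G] [IsTopologicalGroup G] [CompactSpace G]
  [MeasurableSpace G] [BorelSpace G]

/-- `x ^ (3/2) = x · √x` for `0 ≤ x`. -/
private theorem rpow_three_halves_eq_mul_sqrt {x : ℝ} (hx : 0 ≤ x) :
    x ^ (3 / 2 : ℝ) = x * Real.sqrt x := by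
  rw [show (3 / 2 : ℝ) = 1 + 1 / 2 by norm_num, Real.rpow_one_add' hx (by norm_num), Real.sqrt_eq_rpow]

/-- **Ratio floor on the femto boxes of a package map ⇒ signed rigidity** (stub `stub_signedRigidityOfRatioFloor`,
unfolded form): `κ₃ ≥ u₁ ρ₀ · Cov · √Cov` and `Cov > 0` on the boxes `β ≥ max β₁ β₀`, `L · a β ≤ min ℓ₁ ℓ₀`. -/
theorem signedRigidity_of_ratioFloor (r : LatticeRep G) {a : ℝ → ℝ} (hP : TwoPointPackage r a)
    (hF : RatioFloor r a) : SignedRigidity r a := by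
  obtain ⟨ρ₀, hρ₀, hρ⟩ := treeRatioFloor_holds
  obtain ⟨Γ, β₀, ℓ₀, c, C, hℓ₀, hc, hapos, -, hΓ, hbox⟩ := hP
  obtain ⟨β₁, ℓ₁, u₁, hℓ₁, hu₁, hFl⟩ := hF
  refine ⟨max β₁ β₀, min ℓ₁ ℓ₀, u₁ * ρ₀, lt_min hℓ₁ hℓ₀, mul_pos hu₁ hρ₀, ?_⟩
  intro L _ β hβ hL n hn h8
  have hβ₁ : β₁ ≤ β := le_trans (le_max_left _ _) hβ
  have hβ₀ : β₀ ≤ β := le_trans (le_max_right _ _) hβ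
  have hL₁ : (L : ℝ) * a β ≤ ℓ₁ := hL.trans (min_le_left _ _)
  have hL₀ : (L : ℝ) * a β ≤ ℓ₀ := hL.trans (min_le_right _ _)
  -- the package's lower axis clause and the positivity window of `Γ` give `Cov > 0`
  have hlow : c * Γ ((n : ℝ) * a β) ≤ (n : ℝ) ^ 8 * covAxis r L β n := ((hbox L β hβ₀ hL₀).1 n hn h8).1
  obtain ⟨hs, hsl⟩ := level_mem_window hapos hL₀ hn h8
  have hΓpos : 0 < c * Γ ((n : ℝ) * a β) := mul_pos hc (hΓ _ hs hsl).1
  have hn0 : (0 : ℝ) < n := Nat.cast_pos.mpr hn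
  have hn8 : (0 : ℝ) < (n : ℝ) ^ 8 := pow_pos hn0 8
  have hCpos : 0 < covAxis r L β n := pos_of_mul_pos_right (lt_of_lt_of_le hΓpos hlow) hn8.le
  refine ⟨hCpos, ?_⟩
  -- tree-level inputs
  have hA : 0 < torusPropAxis L n := torusPropAxis_pos L n hn h8
  have hD : 0 < torusPropDiag L n := torusPropDiag_pos L n hn h8
  have hDg : ρ₀ * torusPropAxis L n ≤ torusPropDiag L n := hρ L n hn h8
  -- the floor, denominators cleared
  have hP32 : 0 < (covAxis r L β n) ^ (3 / 2 : ℝ) := Real.rpow_pos_of_pos hCpos _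
  have hden : 0 < (covAxis r L β n) ^ (3 / 2 : ℝ) * torusPropDiag L n := mul_pos hP32 hD
  have hu : u₁ ≤ kappa3 r L β n * torusPropAxis L n /
      ((covAxis r L β n) ^ (3 / 2 : ℝ) * torusPropDiag L n) := hFl L β n hβ₁ hL₁ hn h8
  have hu' : u₁ * ((covAxis r L β n) ^ (3 / 2 : ℝ) * torusPropDiag L n) ≤
      kappa3 r L β n * torusPropAxis L n := (le_div_iff₀ hden).1 hu
  -- replace `G_d` by `ρ₀ G_a` on the left
  have h2 : u₁ * ((covAxis r L β n) ^ (3 / 2 : ℝ) * (ρ₀ * torusPropAxis L n)) ≤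
      u₁ * ((covAxis r L β n) ^ (3 / 2 : ℝ) * torusPropDiag L n) :=
    mul_le_mul_of_nonneg_left (mul_le_mul_of_nonneg_left hDg hP32.le) hu₁.le
  have h3 : u₁ * ρ₀ * (covAxis r L β n) ^ (3 / 2 : ℝ) * torusPropAxis L n ≤
      kappa3 r L β n * torusPropAxis L n := by
    have heq : u₁ * ρ₀ * (covAxis r L β n) ^ (3 / 2 : ℝ) * torusPropAxis L n =
        u₁ * ((covAxis r L β n) ^ (3 / 2 : ℝ) * (ρ₀ * torusPropAxis L n)) := by ring
    rw [heq]
    exact h2.trans hu'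
  -- divide by `G_a > 0` and rewrite `Cov^{3/2} = Cov · √Cov`
  have h4 : u₁ * ρ₀ * (covAxis r L β n) ^ (3 / 2 : ℝ) ≤ kappa3 r L β n := le_of_mul_le_mul_right h3 hA
  calc u₁ * ρ₀ * covAxis r L β n * Real.sqrt (covAxis r L β n)
      = u₁ * ρ₀ * (covAxis r L β n * Real.sqrt (covAxis r L β n)) := by ring
    _ = u₁ * ρ₀ * (covAxis r L β n) ^ (3 / 2 : ℝ) := by rw [rpow_three_halves_eq_mul_sqrt hCpos.le]
    _ ≤ kappa3 r L β n := h4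

end Rigidity

/-- **Stub `stub_signedRigidityOfRatioFloor` of the skeleton `Cruxes/FemtoCurvatureSkewnessC/Lines/Sketch.lean`** (registered
signature `Sig.stub_signedRigidityOfRatioFloor = SignedRigidityOfRatioFloor`): for every compact `G`, every `r` and every unit
map `a`, the two-point package together with a ratio floor on its femto boxes gives signed rigidity there. -/
theorem stub_signedRigidityOfRatioFloor : Sig.stub_signedRigidityOfRatioFloor := by
  unfold Sig.stub_signedRigidityOfRatioFloor SignedRigidityOfRatioFloor
  intro G _ _ _ _ _ _ r a hP hF
  exact signedRigidity_of_ratioFloor r hP hF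

end Summit.QuantumFields.YangMills.Cruxes.FemtoCurvatureSkewnessC.RatioTransport

end
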